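import Literature.Probability.RandomPlanarGeometry.HexSAWPolygonCellsHosts
import Literature.Probability.RandomPlanarGeometry.HexSAWPolygonCellsRays
import Literature.Probability.RandomPlanarGeometry.HexSAWPolygonCellsDiag
import HarnessLib

/-!
# Cell calculus for honeycomb polygon surgery, XI: the ports of the flip and of the roof are RAY-CLEAR ((P2) of Lemma P)

Topic `Literature/Probability/RandomPlanarGeometry` (lane «pcv-sawmu», a-p4 g21; sequel of `HexSAWPolygonCellsHosts.lean` ((P1) for the
flip and roof ports) and `HexSAWPolygonCellsRays.lean` (`RayClear`, `perim_union_ray`)).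

`perim_union_ray` re-grows a stick of spikes from a port `p` of an image `C` provided `p` is a clean leaf spot, `UL p ∉ C`, `R p ∉ C`, and
`RayClear C p` (`UR p` is above every hexagon of `C`).  (P1) was proved in part III; this file supplies the remaining three hypotheses —
(P2) of LEMMA P in `HOME/pub-sawmu-a-p4/g21/omega/THEOREM-OMEGA-g21.md` §2 — for the class-X flip image `insert (UL t) S` (ports `UR (UL t)`
for `t`, `UR d` for the other hosts) and for the roof image `S ∪ roof t k` (ports `UR a_{k−1}` for `t`, `UR d` for hosts outside the run).

Sources: N. Madras, G. Slade, *The Self-Avoiding Walk* (1993), §3.2, proof of Theorem 3.2.3 [MadrasSlade1993]; I. Jensen, J. Phys.: Conf.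
Ser. 42 (2006) 163 [Jensen2006HoneycombPolygons].  Label (lane): LANE INFRASTRUCTURE; nothing new in writing.
-/

open Finset

namespace Literature.Probability.RandomPlanarGeometry.SAW

namespace HexCell

/-- Rows of the flip image: `≤ t.y + 1`, and on row `t.y + 1` only `UL t`. [cite: MadrasSlade1993, §3.2 (proof of Theorem 3.2.3)] -/
theorem rows_insert_ul {S : Finset Cell} {t : Cell} (h : IsLexmax S t) :
    ∀ c ∈ insert (UL t) S, c.2 ≤ t.2 + 1 ∧ (c.2 = t.2 + 1 → c = UL t) := by
  intro c hc
  rcases mem_insert.1 hc with rfl | hc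
  · simp
  · rcases h.2 c hc with h1 | ⟨h1, -⟩ <;> exact ⟨by omega, fun h2 => by omega⟩

/-- ★ (P2) for the flip, host `t`: the port `UR (UL t)` is ray-clear, with `UL`/`R` of it outside the image.
[cite: MadrasSlade1993, §3.2 (proof of Theorem 3.2.3)] -/
theorem rayClear_portX {S : Finset Cell} {t : Cell} (h : IsLexmax S t) :
    RayClear (insert (UL t) S) (UR (UL t)) ∧ UL (UR (UL t)) ∉ insert (UL t) S ∧ R (UR (UL t)) ∉ insert (UL t) S := by
  have hr := rows_insert_ul h
  refine ⟨fun c hc => ?_, fun hm => ?_, fun hm => ?_⟩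
  · left; have := (hr c hc).1; simp; omega
  · have := (hr _ hm).1; simp at this
  · have := (hr _ hm).1; simp at this

/-- ★ (P2) for the flip, other hosts: for a host `d ≠ t` of the brick set `S` (with `L t ∈ S`), the default port `UR d` is ray-clear in the
flip image, with `UL`/`R` of it outside. [cite: MadrasSlade1993, §3.2 (proof of Theorem 3.2.3)] -/
theorem rayClear_ur_insert_ul_of_isHost {S : Finset Cell} {t d : Cell} (hS : IsBrickSet S) (h : IsLexmax S t) (hL : L t ∈ S)
    (hd : IsHost S d) (hne : d ≠ t) :
    RayClear (insert (UL t) S) (UR d) ∧ UL (UR d) ∉ insert (UL t) S ∧ R (UR d) ∉ insert (UL t) S := by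
  have hr := rows_insert_ul h
  obtain ⟨a, b⟩ := t
  obtain ⟨x, y⟩ := d
  -- location of `d`: top row with `x ≤ a − 6` (via `R d ∉ S`, `L t ∈ S`, parity) or second row with `x ≥ a + 3`
  have hloc : (y = b ∧ x ≤ a - 6) ∨ (y = b - 1 ∧ a + 3 ≤ x) := by
    rcases hd.row_cases hS h with ⟨hy, -, hx⟩ | h2
    · rcases hx with hx | hx
      · exact absurd hx hne
      · left; refine ⟨hy, ?_⟩
        obtain ⟨m, hm⟩ := hS _ h.1; obtain ⟨m', hm'⟩ := hS _ hd.1; simp only at hm hm' hy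
        have hne4 : x ≠ a - 4 := by
          intro h4; apply hd.2.1
          have : R (x, y) = L (a, b) := by ext <;> simp <;> omega
          rw [this]; exact hL
        omega
    · exact Or.inr h2
  refine ⟨fun c hc => ?_, fun hm => ?_, fun hm => ?_⟩
  · obtain ⟨h1, h2⟩ := hr c hc
    obtain ⟨p, q⟩ := c
    simp only [UR_fst, UR_snd] at h1 h2 ⊢
    rcases hloc with ⟨hy, hx⟩ | ⟨hy, hx⟩
    · -- port row = b + 1; UR of it on row b + 2 > every row of the image
      left; omega
    · -- port row = b; cells on row b + 1: only UL t = (a − 1, b + 1), and a − 1 < x + 2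
      by_cases hq : q = b + 1
      · right
        have e := h2 hq; have e1 := congrArg Prod.fst e; simp at e1
        constructor <;> omega
      · left; omega
  · obtain ⟨h1, h2⟩ := hr _ hm
    simp only [UL_snd, UR_snd] at h1 h2
    rcases hloc with ⟨hy, hx⟩ | ⟨hy, hx⟩
    · omega
    · have e := h2 (by omega); have := congrArg Prod.fst e; simp at this; omega
  · obtain ⟨h1, h2⟩ := hr _ hm
    simp only [R_snd, UR_snd] at h1 h2
    rcases hloc with ⟨hy, hx⟩ | ⟨hy, hx⟩
    · have e := h2 (by omega); have := congrArg Prod.fst e; simp at this; omega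
    · -- `R (UR d) = (x + 3, b)` on the top row right of `t`: not in `S`, not `UL t`
      rcases mem_insert.1 hm with e | hm'
      · have := congrArg Prod.snd e; simp at this; omega
      · exact h.notMem_of_right (by simp; omega) (by simp; omega) hm'

/-- ★ (P2) for the roof, host `t`: the port `UR a_{k−1}` is ray-clear in `S ∪ roof t k`, with `UL`/`R` of it outside.
[cite: MadrasSlade1993, §3.2 (proof of Theorem 3.2.3)] -/
theorem rayClear_portR {S : Finset Cell} {t : Cell} (h : IsLexmax S t) (k : ℕ) :
    RayClear (S ∪ roof t k) (UR (roofCell t (k - 1))) ∧ UL (UR (roofCell t (k - 1))) ∉ S ∪ roof t k ∧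
      R (UR (roofCell t (k - 1))) ∉ S ∪ roof t k := by
  have hr : ∀ c ∈ S ∪ roof t k, c.2 ≤ t.2 := by
    intro c hc
    rcases mem_union.1 hc with hc | hc
    · rcases h.2 c hc with h1 | ⟨h1, -⟩
      · exact h1.le
      · exact h1.le
    · obtain ⟨i, -, rfl⟩ := mem_roof.1 hc; simp
  refine ⟨fun c hc => ?_, fun hm => ?_, fun hm => ?_⟩
  · left; have := hr c hc; simp; omega
  · have := hr _ hm; simp at this
  · have := hr _ hm; simp at this

/-- ★ (P2) for the roof, other hosts: for a host `d ≠ t` outside the run (`e_k ∉ S`), the default port `UR d` is ray-clear in `S ∪ roof t k`,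
with `UL`/`R` of it outside. [cite: MadrasSlade1993, §3.2 (proof of Theorem 3.2.3)] -/
theorem rayClear_ur_union_roof_of_isHost {S : Finset Cell} {t d : Cell} (hS : IsBrickSet S) (h : IsLexmax S t) {k : ℕ}
    (hrun : ∀ i < k, runCell t i ∈ S) (hend : runCell t k ∉ S) (hd : IsHost S d) (hne : d ≠ t)
    (hdr : ∀ i < k, d ≠ runCell t i) :
    RayClear (S ∪ roof t k) (UR d) ∧ UL (UR d) ∉ S ∪ roof t k ∧ R (UR d) ∉ S ∪ roof t k := by
  have hr : ∀ c ∈ S ∪ roof t k, c.2 ≤ t.2 ∧ (c.2 = t.2 → c.1 ≤ t.1 + 2 * k) := by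
    intro c hc
    rcases mem_union.1 hc with hc | hc
    · rcases h.2 c hc with h1 | ⟨h1, h2⟩
      · exact ⟨h1.le, fun e => by omega⟩
      · exact ⟨h1.le, fun _ => by omega⟩
    · obtain ⟨i, hi, rfl⟩ := mem_roof.1 hc; simp; omega
  obtain ⟨a, b⟩ := t
  obtain ⟨x, y⟩ := d
  -- location: top row with x ≤ a − 4, or second row beyond the run: x ≥ a + 2k + 3
  have hloc : (y = b ∧ x ≤ a - 4) ∨ (y = b - 1 ∧ a + 2 * k + 3 ≤ x) := by
    rcases hd.row_cases hS h with ⟨hy, -, hx⟩ | ⟨hy, -⟩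
    · rcases hx with hx | hx
      · exact absurd hx hne
      · exact Or.inl ⟨hy, hx⟩
    · right
      have := hd.lowRow_ge_of_run hS h hrun hend hy hdr
      simp only at hy this ⊢; exact ⟨hy, this⟩
  refine ⟨fun c hc => ?_, fun hm => ?_, fun hm => ?_⟩
  · obtain ⟨h1, h2⟩ := hr c hc
    obtain ⟨p, q⟩ := c
    simp only [UR_fst, UR_snd] at h1 h2 ⊢
    rcases hloc with ⟨hy, hx⟩ | ⟨hy, hx⟩
    · left; omega
    · left; omega
  · obtain ⟨h1, -⟩ := hr _ hm
    simp only [UL_snd, UR_snd] at h1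
    rcases hloc with ⟨hy, -⟩ | ⟨hy, hx⟩
    · omega
    · omega
  · obtain ⟨h1, h2⟩ := hr _ hm
    simp only [R_fst, R_snd, UR_fst, UR_snd] at h1 h2
    rcases hloc with ⟨hy, -⟩ | ⟨hy, hx⟩
    · omega
    · have := h2 (by omega); omega

end HexCell

end Literature.Probability.RandomPlanarGeometry.SAW
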